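import Summits.QuantumFields.YangMills.Theorems.BalabanUVNodesN15BackgroundVWordsCoarse
import HarnessLib

/-!
# Route «BalabanUVNodes» (K4 «SpineRates»), node N15 = NE2, BACKGROUND LAYER — `NE2PlusOperator` BY NAME WITH THE (3.60)-SHAPED FULL PERTURBATION LIVE, THE GAUGE
# FIELD THE DATUM, AND THE COARSE `V′₁` AT THE MEAN FIELD's OWN TRIPLE (F3's `ne2PlusOperator_vWG` + the block-translation law)

Cell `pub-ymgap`, seat `pub-ymgap-dag-n15-c` (generation g4; R134 ACCELERATION SEAT, strategy s1; HUMAN RULING D-0062; chair R424 venue; `bears_on: R4∕N15`).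
Filed `--supports stmt-QuantumFields-19912 --as helper` (K3‴ `SpineGivenEndpointR13`; KEY TABLE WORDS-133; helper, count-neutral).  Imports BY NAME, nothing in the
tree modified: this seat's `…N15BackgroundVWordsCoarse` (`vWGCFamily4`, `vWGOpsC4`, **`etaRateIneq342_vWEntriesC`**), F2 (`gVWc35`, `le_gVWc35`), g3 (`v1GaugeBg`,
`v1GaugeInstance`), g0 (`bgConst`∕`bgConst1`, `opGeo_len`), n15-b A2 (`one_le_pref4`); the text of F3's `ne2PlusOperator_vWG` is the template.

CONTENTS (namespace `…N15.BackgroundLayer`).  ★ **`ne2PlusOperator_vWGC`**: for ANY family as in F3's `ne2PlusOperator_vWG` (commuting shifts, `C_π`-step-connected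
fibres, `C_π(i)η′_i ≤ C₀θ_i`, ANY block-local word species with the sup∕fit letters at `c_W·c₃₅M_iα₀` in the smallness regime `2c₃₅M_iα₀ ≤ 1`) PLUS the block-translation
law `π_i∘(s′_{i,μ})^{N_i} = s_{i,μ}∘π_i`, `η_i = N_iη′_i`: the instances `v1GaugeInstance` with the families `vWGCFamily4` satisfy `NE2PlusOperator c₃₅` (inside:
`c′ = (2+|J|)(1+C₀)c₃₅`, `M₅ = 1`, `a₀ = (2·gVWc35(2c′)·(βc_r + 1))⁻¹`, `B₀ = bgConst + bgConst1 + 1`, `δ₀ = δ − σ`).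

HONEST FRAMING ∕ LIMITS.  Transport = fibrewise mean (linearised (C3)); `U ≡ 1` shapes; crude constants; generic carriers (realised knit = the sequel
`…N15VectorPieceVWordsCoarse`).  NE2⁺ NOT PRINTED; count-neutral (typed 28∕28 · discharged unchanged); NOT a discharge of N15; one finite lattice at fixed ε — NOT
infinite volume, NOT OS on ℝ⁴, NOT a mass gap, NOT Clay.
-/

noncomputable section

open scoped BigOperators

namespace Summit.QuantumFields.YangMills.BalabanUVNodes.N15.BackgroundLayer

open Literature.MathematicalPhysics.QuantumFieldTheory.Balaban1983to89
open Literature.MathematicalPhysics.QuantumFieldTheory.Balaban1983to89.B11SectG (BlockNorm HasMaj RowSum)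
open Literature.MathematicalPhysics.QuantumFieldTheory.Balaban1983to89.T4EtaRate (PairedInstance NE2PlusOperator rateFactor)
open Literature.MathematicalPhysics.QuantumFieldTheory.Balaban1983to89.T4EtaRateDefect (idef rateWeight)
open Literature.MathematicalPhysics.QuantumFieldTheory.Balaban1983to89.T4EtaRateCoeffDefect (pull diagK diagK_mono)
open Literature.MathematicalPhysics.QuantumFieldTheory.Balaban1983to89.B6RandomWalk (Triangle254)
open Summit.QuantumFields.YangMills.BalabanUVNodes.N15.OperatorReadout (opGeo opFamily opGeo_len)
open Summit.QuantumFields.YangMills.BalabanUVNodes.N15.MatrixSpecies (liftMap liftBlk basisConst basisConst_nonneg)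

section Node

variable {I J ι : Type} [Fintype J] [DecidableEq J] [Fintype ι] [DecidableEq ι] {𝔄 : Type} [NormedRing 𝔄] [NormedAlgebra ℝ 𝔄] [CompleteSpace 𝔄]
  (e : 𝔄 ≃L[ℝ] (ι → ℝ)) (g : I → B6.Geometry) (X X' : I → Type) [∀ i, Fintype (X i)] [∀ i, Fintype (X' i)] [∀ i, DecidableEq (X i)]
  [∀ i, DecidableEq (X' i)] (blk : ∀ i, X i → (g i).Site) (π : ∀ i, X' i → X i) (nsh : I → ℕ) (hL0 : ∀ i, (g i).L ≠ 0) (θc θ : I → ℝ) (ν : I → J ⊕ J)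
  (G S D₃ : ∀ i, (X i × ι → ℝ) →ₗ[ℝ] (X i × ι → ℝ)) (D SD : ∀ i, J ⊕ J → (X i × ι → ℝ) →ₗ[ℝ] (X i × ι → ℝ))
  (G' S' D₃' : ∀ i, (X' i × ι → ℝ) →ₗ[ℝ] (X' i × ι → ℝ)) (D' SD' : ∀ i, J ⊕ J → (X' i × ι → ℝ) →ₗ[ℝ] (X' i × ι → ℝ))


variable (s : ∀ i, J → X i ≃ X i) (s' : ∀ i, J → X' i ≃ X' i) (Cπ : I → ℝ) (Nst : I → ℕ)

/-- **NE2⁺, OPERATOR LAYER — `T4EtaRate.NE2PlusOperator` BY NAME, (3.60)-SHAPED FULL PERTURBATION LIVE, GAUGE FIELD THE DATUM, COARSE `V′₁` AT THE MEAN FIELD's OWN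
TRIPLE.**  F3's `ne2PlusOperator_vWG` (ANY family: [B6] carriers, uniform (2.61), the `U ≡ 1` layer on the forward∕backward stack with uniform letters, commuting unit
shifts, `C_π(i)`-step-connected pairing fibres with `C_π(i)·η′_i ≤ C₀·θ_i`, ANY block-local word species `Wc i A′`, `Wf i A′` with the sup letters `≤ diagK
(c_W·c₃₅M_iα₀)` and the fit letter `≤ diagK (c_W·c₃₅M_iα₀·θ_i)` in the smallness regime `2c₃₅M_iα₀ ≤ 1`) with ONE hypothesis more — the block-translation law
`π_i((s′_{i,μ})^{N_i} x′) = s_{i,μ}(π_i x′)`, `η_i = N_iη′_i` — and the families `vWGCFamily4`: `NE2PlusOperator c₃₅` (inside: `c′ = (2+|J|)(1+C₀)c₃₅`, `M₅ = 1`,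
`a₀ = (2·gVWc35(2c′)·(βc_r + 1))⁻¹`, `B₀ = bgConst + bgConst1 + 1`, `δ₀ = δ − σ`).
[cite: Balaban1985BackgroundPropagators, Thm 3.1 p.397 (quantifier template); (3.35)–(3.36) p.396, (3.42) p.397, (3.44) p.398, (3.52) p.400, (3.59)–(3.65) pp.402–403 (shapes, mechanism)] -/
theorem ne2PlusOperator_vWGC (c35 : ℝ) (hc35 : 0 < c35)
    (Wc : ∀ i, (J → X' i → 𝔄) → ((X i × ι → ℝ) →ₗ[ℝ] (X i × ι → ℝ))) (Wf : ∀ i, (J → X' i → 𝔄) → ((X' i × ι → ℝ) →ₗ[ℝ] (X' i × ι → ℝ)))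
    (htri : ∀ i, Triangle254 (g i)) (hd : ∀ i (a b : (g i).Site), 0 ≤ (g i).dist a b) {σ cr : ℝ} (hσ : 0 ≤ σ) (hcr : 0 ≤ cr)
    (hrow : ∀ i, RowSum (g i) σ cr) (hη : ∀ i, 0 < (g i).eta) (hη1 : ∀ i, (g i).eta ≤ 1) (hηθ : ∀ i, (g i).eta ≤ θ i) (hL : ∀ i, 1 ≤ (g i).L)
    (hlen : ∀ i y, 1 ≤ (g i).len y) {δ β m₀ γ cW : ℝ} (hσδ : σ < δ) (hβ : 0 ≤ β) (hm₀ : 0 ≤ m₀) (hγ : 0 < γ) (hθγ : ∀ i y, θ i ≤ rateWeight (g i) γ y)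
    (hcomm : ∀ i μ κ x, (s' i μ).symm (s' i κ x) = s' i κ ((s' i μ).symm x)) (hCπ : ∀ i, 0 ≤ Cπ i)
    (hconn : ∀ i (f : X' i → 𝔄) (b : ℝ), (∀ κ x, ‖f (s' i κ x) - f x‖ ≤ b) → ∀ x₁ x₂, π i x₁ = π i x₂ → ‖f x₁ - f x₂‖ ≤ Cπ i * b)
    {C₀ : ℝ} (hC₀ : 0 ≤ C₀) (hCθ : ∀ i, Cπ i * ((g i).eta * ((g i).L ^ nsh i)⁻¹) ≤ C₀ * θ i) (hcW : 0 ≤ cW)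
    (hblk : ∀ i μ x', π i ((s' i μ ^ Nst i) x') = s i μ (π i x')) (hN : ∀ i, (g i).eta = Nst i * ((g i).eta * ((g i).L ^ nsh i)⁻¹))
    (hWc : ∀ i (α₀ : ℝ) A', 0 < α₀ → 2 * (c35 * ((g i).M * α₀)) ≤ 1 → (v1GaugeBg 𝔄 J (s' i) ((g i).eta * ((g i).L ^ nsh i)⁻¹) (g i).M).Reg335 c35 α₀ A' →
      HasMaj (BlockNorm.ofBlocks (g i) (liftBlk (blk i) ι)) (BlockNorm.ofBlocks (g i) (liftBlk (blk i) ι)) (Wc i A') (diagK fun _ => cW * (c35 * (g i).M * α₀)))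
    (hWf : ∀ i (α₀ : ℝ) A', 0 < α₀ → 2 * (c35 * ((g i).M * α₀)) ≤ 1 → (v1GaugeBg 𝔄 J (s' i) ((g i).eta * ((g i).L ^ nsh i)⁻¹) (g i).M).Reg335 c35 α₀ A' →
      HasMaj (BlockNorm.ofBlocks (g i) (liftBlk (blk i ∘ π i) ι)) (BlockNorm.ofBlocks (g i) (liftBlk (blk i ∘ π i) ι)) (Wf i A')
        (diagK fun _ => cW * (c35 * (g i).M * α₀)))
    (hDW : ∀ i (α₀ : ℝ) A', 0 < α₀ → 2 * (c35 * ((g i).M * α₀)) ≤ 1 → (v1GaugeBg 𝔄 J (s' i) ((g i).eta * ((g i).L ^ nsh i)⁻¹) (g i).M).Reg335 c35 α₀ A' →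
      HasMaj (BlockNorm.ofBlocks (g i) (liftBlk (blk i) ι)) (BlockNorm.ofBlocks (g i) (liftBlk (blk i ∘ π i) ι))
        (idef (pull (liftMap (π i) ι)) (pull (liftMap (π i) ι)) (Wf i A') (Wc i A')) (diagK fun _ => cW * (c35 * (g i).M * α₀) * θ i))
    (hG : ∀ i, HasMaj (BlockNorm.ofBlocks (g i) (liftBlk (blk i) ι)) (BlockNorm.ofBlocks (g i) (liftBlk (blk i) ι)) (G i)
      (fun y y' => β * Real.exp (-(δ * (g i).dist y y'))))
    (hD : ∀ i μ, HasMaj (BlockNorm.ofBlocks (g i) (liftBlk (blk i) ι)) (BlockNorm.ofBlocks (g i) (liftBlk (blk i) ι)) (D i μ)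
      (fun y y' => β * Real.exp (-(δ * (g i).dist y y'))))
    (hG' : ∀ i, HasMaj (BlockNorm.ofBlocks (g i) (liftBlk (blk i ∘ π i) ι)) (BlockNorm.ofBlocks (g i) (liftBlk (blk i ∘ π i) ι)) (G' i)
      (fun y y' => β * Real.exp (-(δ * (g i).dist y y'))))
    (hD' : ∀ i μ, HasMaj (BlockNorm.ofBlocks (g i) (liftBlk (blk i ∘ π i) ι)) (BlockNorm.ofBlocks (g i) (liftBlk (blk i ∘ π i) ι)) (D' i μ)
      (fun y y' => β * Real.exp (-(δ * (g i).dist y y'))))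
    (hS : ∀ i, HasMaj (BlockNorm.ofBlocks (g i) (liftBlk (blk i) ι)) (BlockNorm.ofBlocks (g i) (liftBlk (blk i) ι)) (S i)
      (fun y y' => β * Real.exp (-(δ * (g i).dist y y'))))
    (hSD : ∀ i μ, HasMaj (BlockNorm.ofBlocks (g i) (liftBlk (blk i) ι)) (BlockNorm.ofBlocks (g i) (liftBlk (blk i) ι)) (SD i μ)
      (fun y y' => β * Real.exp (-(δ * (g i).dist y y'))))
    (hD₃' : ∀ i, HasMaj (BlockNorm.ofBlocks (g i) (liftBlk (blk i ∘ π i) ι)) (BlockNorm.ofBlocks (g i) (liftBlk (blk i ∘ π i) ι)) (D₃' i)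
      (fun y y' => β * Real.exp (-(δ * (g i).dist y y'))))
    (hDG : ∀ i, HasMaj (BlockNorm.ofBlocks (g i) (liftBlk (blk i) ι)) (BlockNorm.ofBlocks (g i) (liftBlk (blk i ∘ π i) ι))
      (idef (pull (liftMap (π i) ι)) (pull (liftMap (π i) ι)) (G' i) (G i)) (fun y y' => m₀ * θ i * Real.exp (-(δ * (g i).dist y y'))))
    (hDD : ∀ i μ, HasMaj (BlockNorm.ofBlocks (g i) (liftBlk (blk i) ι)) (BlockNorm.ofBlocks (g i) (liftBlk (blk i ∘ π i) ι))
      (idef (pull (liftMap (π i) ι)) (pull (liftMap (π i) ι)) (D' i μ) (D i μ)) (fun y y' => m₀ * θ i * Real.exp (-(δ * (g i).dist y y'))))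
    (hDS : ∀ i, HasMaj (BlockNorm.ofBlocks (g i) (liftBlk (blk i) ι)) (BlockNorm.ofBlocks (g i) (liftBlk (blk i ∘ π i) ι))
      (idef (pull (liftMap (π i) ι)) (pull (liftMap (π i) ι)) (S' i) (S i)) (fun y y' => m₀ * θ i * Real.exp (-(δ * (g i).dist y y'))))
    (hDSD : ∀ i μ, HasMaj (BlockNorm.ofBlocks (g i) (liftBlk (blk i) ι)) (BlockNorm.ofBlocks (g i) (liftBlk (blk i ∘ π i) ι))
      (idef (pull (liftMap (π i) ι)) (pull (liftMap (π i) ι)) (SD' i μ) (SD i μ)) (fun y y' => m₀ * θ i * Real.exp (-(δ * (g i).dist y y'))))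
    (hDD₃ : ∀ i, HasMaj (BlockNorm.ofBlocks (g i) (liftBlk (blk i) ι)) (BlockNorm.ofBlocks (g i) (liftBlk (blk i ∘ π i) ι))
      (idef (pull (liftMap (π i) ι)) (pull (liftMap (π i) ι)) (D₃' i) (D₃ i)) (fun y y' => m₀ * θ i * Real.exp (-(δ * (g i).dist y y')))) :
    NE2PlusOperator c35 (fun i => v1GaugeInstance 𝔄 J ι (blk i) (π i) (s i) (s' i) (nsh i) (hL0 i))
      (fun i => vWGCFamily4 e (blk i) (π i) (Wc i) (Wf i) (s i) (s' i) (nsh i) (hL0 i) (ν i) (G i) (S i) (D₃ i) (D i) (SD i) (G' i) (S' i) (D₃' i)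
        (D' i) (SD' i)) := by
  -- the effective (3.35) constant of the derived triple
  have hJ0 : (0 : ℝ) ≤ Fintype.card J := Nat.cast_nonneg _
  set c' : ℝ := (2 + Fintype.card J) * (1 + C₀) * c35 with hc'
  have hc'pos : 0 < c' := by positivity
  have hc35c' : c35 ≤ 2 * c' := by
    rw [hc']
    have h1 : (1 : ℝ) ≤ 2 * ((2 + Fintype.card J) * (1 + C₀)) := by nlinarith [mul_nonneg hJ0 hC₀]
    nlinarith
  have h2c'pos : 0 < 2 * c' := by positivity
  obtain ⟨hcg, hgpos, _⟩ := le_gVWc35 (J := J) (basisConst_nonneg e) h2c'pos hcW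
  set a₀ : ℝ := (2 * gVWc35 J (basisConst e) (2 * c') cW * (β * cr + 1))⁻¹ with ha₀_def
  have hden : 0 < 2 * gVWc35 J (basisConst e) (2 * c') cW * (β * cr + 1) := by positivity
  have ha₀ : 0 < a₀ := inv_pos.2 hden
  have hq : β * (gVWc35 J (basisConst e) (2 * c') cW * a₀) * cr ≤ 1 / 2 := by
    have h1 : β * (gVWc35 J (basisConst e) (2 * c') cW * a₀) * cr = (β * cr) * (gVWc35 J (basisConst e) (2 * c') cW * a₀) := by ring
    have h2 : gVWc35 J (basisConst e) (2 * c') cW * a₀ = (2 * (β * cr + 1))⁻¹ := by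
      rw [ha₀_def]; field_simp
    rw [h1, h2, ← div_eq_mul_inv, div_le_iff₀ (by positivity)]
    nlinarith [mul_nonneg hβ hcr]
  have ha₀1 : 2 * (2 * c' * a₀) ≤ 1 := by
    have h2 : 2 * (2 * c' * a₀) = (2 * c') / (gVWc35 J (basisConst e) (2 * c') cW * (β * cr + 1)) := by
      rw [ha₀_def]; field_simp
    rw [h2, div_le_one (by positivity)]
    nlinarith [mul_nonneg hβ hcr, hgpos]
  have hC0 : 0 ≤ bgConst β cr m₀ (gVWc35 J (basisConst e) (2 * c') cW) a₀ := bgConst_nonneg hβ hcr hm₀ hgpos.le ha₀.le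
  have hC1 : 0 ≤ bgConst1 β cr m₀ (gVWc35 J (basisConst e) (2 * c') cW) a₀ := bgConst1_nonneg hβ hcr hm₀ hgpos.le ha₀.le
  refine ⟨1, δ - σ, a₀, bgConst β cr m₀ (gVWc35 J (basisConst e) (2 * c') cW) a₀ + bgConst1 β cr m₀ (gVWc35 J (basisConst e) (2 * c') cW) a₀ + 1, γ, one_pos,
    by linarith, ha₀, by linarith, hγ, fun i hM α₀ hα₀ hMα A' hreg => ?_⟩
  have hM' : 1 ≤ (g i).M := hM
  have hMα' : (g i).M * α₀ ≤ a₀ := hMα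
  have hM0 : 0 ≤ (g i).M := zero_le_one.trans hM'
  have hLpos : 0 < (g i).L := lt_of_lt_of_le one_pos (hL i)
  have hη'pos : 0 < (g i).eta * ((g i).L ^ nsh i)⁻¹ := mul_pos (hη i) (inv_pos.2 (pow_pos hLpos _))
  have hη'η : (g i).eta * ((g i).L ^ nsh i)⁻¹ ≤ (g i).eta := by
    have h1 : ((g i).L ^ nsh i)⁻¹ ≤ 1 := inv_le_one_of_one_le₀ (one_le_pow₀ (hL i))
    calc (g i).eta * ((g i).L ^ nsh i)⁻¹ ≤ (g i).eta * 1 := mul_le_mul_of_nonneg_left h1 (hη i).le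
      _ = (g i).eta := mul_one _
  have hθ0 : 0 ≤ θ i := (hη i).le.trans (hηθ i)
  -- the constants of `vWC_letters_of_gauge` at `c′ = (2+|J|)(1+C₀)c₃₅`
  have hcc' : (2 + Fintype.card J) * c35 ≤ c' := by
    rw [hc']
    have h0 : 0 ≤ (2 + Fintype.card J) * c35 := by positivity
    nlinarith [mul_nonneg hC₀ h0]
  have hθ' : (1 + Fintype.card J) * Cπ i * (c35 * (g i).M * α₀) * ((g i).eta * ((g i).L ^ nsh i)⁻¹) ≤ c' * (g i).M * α₀ * θ i := by
    have h0 : 0 ≤ (1 + Fintype.card J) * (c35 * (g i).M * α₀) := by positivity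
    have hMα0 : 0 ≤ (g i).M * α₀ := mul_nonneg hM0 hα₀.le
    have hcoef : (1 + Fintype.card J) * C₀ * c35 ≤ c' := by
      rw [hc']; nlinarith [mul_nonneg hC₀ hJ0, hc35.le, mul_nonneg (mul_nonneg hC₀ hJ0) hc35.le, mul_nonneg hJ0 hc35.le, mul_nonneg hC₀ hc35.le]
    calc (1 + Fintype.card J) * Cπ i * (c35 * (g i).M * α₀) * ((g i).eta * ((g i).L ^ nsh i)⁻¹)
        = (1 + Fintype.card J) * (c35 * (g i).M * α₀) * (Cπ i * ((g i).eta * ((g i).L ^ nsh i)⁻¹)) := by ring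
      _ ≤ (1 + Fintype.card J) * (c35 * (g i).M * α₀) * (C₀ * θ i) := mul_le_mul_of_nonneg_left (hCθ i) h0
      _ = ((1 + Fintype.card J) * C₀ * c35) * ((g i).M * α₀) * θ i := by ring
      _ ≤ c' * ((g i).M * α₀) * θ i := mul_le_mul_of_nonneg_right (mul_le_mul_of_nonneg_right hcoef hMα0) hθ0
      _ = c' * (g i).M * α₀ * θ i := by ring
  have hregA : (v1GaugeBg 𝔄 J (s' i) ((g i).eta * ((g i).L ^ nsh i)⁻¹) (g i).M).Reg335 c35 α₀ A' := hreg
  -- the species letters, moved from `c₃₅` to `c′`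
  have hmono : cW * (c35 * (g i).M * α₀) ≤ cW * (2 * c' * (g i).M * α₀) :=
    mul_le_mul_of_nonneg_left (mul_le_mul_of_nonneg_right (mul_le_mul_of_nonneg_right hc35c' hM0) hα₀.le) hcW
  have hsm : 2 * (c35 * ((g i).M * α₀)) ≤ 1 :=
    (mul_le_mul_of_nonneg_left ((mul_le_mul_of_nonneg_left hMα' hc35.le).trans (mul_le_mul_of_nonneg_right hc35c' ha₀.le)) zero_le_two).trans ha₀1
  have hWc' := (hWc i α₀ A' hα₀ hsm hregA).mono fun y y' => diagK_mono (fun _ => hmono) y y'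
  have hWf' := (hWf i α₀ A' hα₀ hsm hregA).mono fun y y' => diagK_mono (fun _ => hmono) y y'
  have hDW' := (hDW i α₀ A' hα₀ hsm hregA).mono fun y y' => diagK_mono (fun _ => mul_le_mul_of_nonneg_right hmono hθ0) y y'
  have key := etaRateIneq342_vWEntriesC e (J := J) (blk i) (π i) (B := v1GaugeBg 𝔄 J (s' i) ((g i).eta * ((g i).L ^ nsh i)⁻¹) (g i).M)
    (vWGOpsC4 e (π i) (Wc i) (Wf i) (s i) (s' i) (g i).eta ((g i).eta * ((g i).L ^ nsh i)⁻¹) (ν i)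
      (G i) (S i) (D₃ i) (D i) (SD i) (G' i) (S' i) (D₃' i) (D' i) (SD' i)) A' (fun _ => rfl) (htri i) (hd i) hσ hcr (hrow i) (hη i) hLpos (hlen i)
    hσδ.le hβ hm₀ hθ0 (hθγ i) (hcomm i) (hCπ i) (hconn i) (hblk i) hη'pos hη'η (hη1 i) (hηθ i) (hN i) hc35.le hc'pos hcc' hθ' hM' hα₀ hMα' ha₀.le ha₀1
    hq hcW (hG i) (hD i) (hG' i) (hD' i) (hS i) (hSD i) (hD₃' i) (hDG i) (hDD i) (hDS i) (hDSD i) (hDD₃ i) hregA hWc' hWf' hDW'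
  intro n lam y y' hsupp
  refine (key n lam y y' hsupp).trans ?_
  have hpref : 0 ≤ B9.pref4 ((v1GaugeInstance 𝔄 J ι (blk i) (π i) (s i) (s' i) (nsh i) (hL0 i)).gc.len y) n := by
    have : 1 ≤ B9.pref4 ((opGeo (g i) (X i × ι) (liftBlk (blk i) ι)).len y) n := by rw [opGeo_len]; exact one_le_pref4 (hlen i y) n
    exact zero_le_one.trans this
  have hrf : 0 ≤ max (rateFactor (v1GaugeInstance 𝔄 J ι (blk i) (π i) (s i) (s' i) (nsh i) (hL0 i)).gc γ y)
      (rateFactor (v1GaugeInstance 𝔄 J ι (blk i) (π i) (s i) (s' i) (nsh i) (hL0 i)).gc γ y') :=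
    (T4EtaRate.rateFactor_nonneg (g := opGeo (g i) (X i × ι) (liftBlk (blk i) ι)) (hη i).le hLpos.le γ y).trans (le_max_left _ _)
  have hnorm : 0 ≤ (v1GaugeInstance 𝔄 J ι (blk i) (π i) (s i) (s' i) (nsh i) (hL0 i)).gc.supNorm lam := Real.iSup_nonneg fun x => abs_nonneg _
  have hE : 0 ≤ Real.exp (-((δ - σ) * (v1GaugeInstance 𝔄 J ι (blk i) (π i) (s i) (s' i) (nsh i) (hL0 i)).gc.dist y y')) := Real.exp_nonneg _
  exact mul_le_mul_of_nonneg_right (mul_le_mul_of_nonneg_right (mul_le_mul_of_nonneg_right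
    (mul_le_mul_of_nonneg_right (le_add_of_nonneg_right zero_le_one) hpref) hE) hrf) hnorm


end Node

end Summit.QuantumFields.YangMills.BalabanUVNodes.N15.BackgroundLayer

end
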